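import Mathlib.Analysis.SpecialFunctions.Log.Basic
import Mathlib.Analysis.SpecialFunctions.Pow.Real
import Mathlib.Analysis.SpecialFunctions.Sqrt
import Mathlib.Order.Filter.AtTopBot.Basic
import Mathlib.Topology.Algebra.Order.LiminfLimsup
import Mathlib.Topology.MetricSpace.Basic
import HarnessLib

/-!
# Moderate deviations of a finitely supported statistic from a UNIFORM quadratic expansion of its log-Laplace transform

Model-free engine (finite exponential families).  Fix, for each index `n`, a finite family of nonnegative weights `w_n(i)`, `i ∈ S_n`, with
`Z_n := Σ_i w_n(i) > 0`, and real values `X_n(i)`; write `P_n` for the probability `w_n/Z_n`, `Z_n(t) := Σ_i w_n(i) e^{t X_n(i)}` for the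
tilted partition function, `a_n > 0` for a scale and `c_n` for a centring.  The hypothesis of §3–§5 is the
UNIFORM QUADRATIC EXPANSION (UQE) of the log-Laplace transform of `(X_n − c_n)/a_n` with curvature `H > 0`:

  for every `η > 0` there is `δ > 0` such that, eventually in `n`, for ALL real `s` with `|s| ≤ δ a_n`,
  `|log (Z_n(s/a_n)/Z_n) − s c_n/a_n − H s²/2| ≤ η s² + η`.

(For the lane's strip models `a_n = √n`, `c_n = n·b` and UQE is the uniform second-order Taylor squeeze of a `C²` free energy — see
`Literature/Analysis/Asymptotics/UniformQuadraticTiltExpansion.lean`; the present file never mentions a model.)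

* §1 (one family, finite sums) the two exponential Chebyshev inequalities `e^{tA}·Σ_{X ≥ A} w ≤ Z(t)` (`t ≥ 0`), `e^{tA}·Σ_{X ≤ A} w ≤ Z(t)`
  (`t ≤ 0`), and ★★ the WINDOW LOWER BOUNDS (Cramér's change of measure, finite form)
  `e^{tA'}·Σ_{X ≥ A} w + e^{−τA'} Z(t+τ) + e^{τ'A} Z(t−τ') ≥ Z(t)` (`t, τ, τ' ≥ 0`) and its downward twin.
* §2 reflection `X ↦ −X`, `c ↦ −c` preserves UQE (so lower tails follow from upper tails).
* §3 ★★★ UPPER BOUNDS: if `ξ_n → ∞`, `ξ_n/a_n → 0` then for every `η > 0`, eventually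
  `P_n(X_n ≥ c_n + ξ_n a_n) ≤ exp(−(1−η) ξ_n²/(2H))` and `P_n(X_n ≤ c_n − ξ_n a_n) ≤ exp(−(1−η) ξ_n²/(2H))` (Chebyshev at the tilt `s = ±ξ_n/H`).
* §4 ★★★ LOWER BOUNDS: eventually `P_n(X_n ≥ c_n + ξ_n a_n) ≥ exp(−(1+η) ξ_n²/(2H))` and the twin (change of measure to the tilt
  `s = (1+κ)ξ_n/H`, window of half-width `κ ξ_n a_n`, the two tails of the TILTED family removed by §1 under UQE at `s ± κξ_n/H`).
* §5 ★★★ THE MODERATE DEVIATION PRINCIPLE `ξ_n^{-2} log P_n(X_n ≷ c_n ± ξ_n a_n) → −1/(2H)`.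

Index set: an arbitrary type with a filter `l` (sequences, parity subsequences, nets).

## Sources
A. Dembo, O. Zeitouni, *Large Deviations Techniques and Applications* (2010): §2.3 (exponential Chebyshev upper bound; Gärtner–Ellis lower bound by
change of measure) and §3.7 (moderate deviations).  The statements here are elementary lane statements (lane «pcv-sawmu», a-p5 g27), not
quotations; constants are ours.
-/

noncomputable section

open Finset Filter Set
open scoped Topology

namespace Literature.Probability.Moments

/-! ## §1 One finite family: Chebyshev and the window lower bounds -/

section OneFamily

variable {ι : Type*} (S : Finset ι) (w X : ι → ℝ)

open Classical in
/-- **Exponential Chebyshev, upper side (finite form).** For nonnegative weights and `t ≥ 0`: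
`e^{tA} · Σ_{i : A ≤ X i} w_i ≤ Σ_i w_i e^{t X_i}`. [cite: DemboZeitouni2010, §2.3 (exponential Chebyshev inequality; lane statement)] -/
theorem exp_mul_sum_filter_ge_le_tiltSum (hw : ∀ i ∈ S, 0 ≤ w i) {t : ℝ} (ht : 0 ≤ t) (A : ℝ) :
    Real.exp (t * A) * ∑ i ∈ S.filter (fun i => A ≤ X i), w i ≤ ∑ i ∈ S, w i * Real.exp (t * X i) := by
  rw [Finset.mul_sum]
  calc ∑ i ∈ S.filter (fun i => A ≤ X i), Real.exp (t * A) * w i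
      ≤ ∑ i ∈ S.filter (fun i => A ≤ X i), w i * Real.exp (t * X i) :=
        Finset.sum_le_sum fun i hi => by
          rw [mul_comm]
          exact mul_le_mul_of_nonneg_left (Real.exp_le_exp.2 (mul_le_mul_of_nonneg_left (Finset.mem_filter.1 hi).2 ht))
            (hw i (Finset.mem_filter.1 hi).1)
    _ ≤ ∑ i ∈ S, w i * Real.exp (t * X i) :=
        Finset.sum_le_sum_of_subset_of_nonneg (Finset.filter_subset _ _) fun i hi _ =>
          mul_nonneg (hw i hi) (Real.exp_pos _).le

open Classical in
/-- **Exponential Chebyshev, lower side (finite form).** For nonnegative weights and `t ≤ 0`: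
`e^{tA} · Σ_{i : X i ≤ A} w_i ≤ Σ_i w_i e^{t X_i}`. [cite: DemboZeitouni2010, §2.3 (exponential Chebyshev inequality; lane statement)] -/
theorem exp_mul_sum_filter_le_le_tiltSum (hw : ∀ i ∈ S, 0 ≤ w i) {t : ℝ} (ht : t ≤ 0) (A : ℝ) :
    Real.exp (t * A) * ∑ i ∈ S.filter (fun i => X i ≤ A), w i ≤ ∑ i ∈ S, w i * Real.exp (t * X i) := by
  rw [Finset.mul_sum]
  calc ∑ i ∈ S.filter (fun i => X i ≤ A), Real.exp (t * A) * w i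
      ≤ ∑ i ∈ S.filter (fun i => X i ≤ A), w i * Real.exp (t * X i) :=
        Finset.sum_le_sum fun i hi => by
          rw [mul_comm]
          exact mul_le_mul_of_nonneg_left (Real.exp_le_exp.2 (mul_le_mul_of_nonpos_left (Finset.mem_filter.1 hi).2 ht))
            (hw i (Finset.mem_filter.1 hi).1)
    _ ≤ ∑ i ∈ S, w i * Real.exp (t * X i) :=
        Finset.sum_le_sum_of_subset_of_nonneg (Finset.filter_subset _ _) fun i hi _ =>
          mul_nonneg (hw i hi) (Real.exp_pos _).le

open Classical in
/-- Tilting the tilted family: `Σ (w e^{tX}) e^{uX} = Σ w e^{(t+u)X}`. [cite: DemboZeitouni2010, §2.3 (lane plumbing)] -/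
theorem tiltSum_tilt (t u : ℝ) :
    ∑ i ∈ S, (w i * Real.exp (t * X i)) * Real.exp (u * X i) = ∑ i ∈ S, w i * Real.exp ((t + u) * X i) :=
  Finset.sum_congr rfl fun i _ => by rw [mul_assoc, ← Real.exp_add]; ring_nf

open Classical in
/-- ★★ **THE WINDOW LOWER BOUND, upward tilt (Cramér's change of measure, finite form).**  For nonnegative weights, `t, τ, τ' ≥ 0` and reals
`A, A'`: `Σ_i w_i e^{tX_i} ≤ e^{tA'}·Σ_{X ≥ A} w + e^{−τA'}·Σ w e^{(t+τ)X} + e^{τ'A}·Σ w e^{(t−τ')X}` — on the window `A ≤ X ≤ A'` undo the tilt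
(`e^{tX} ≤ e^{tA'}`), above `A'` and below `A` bound the tilted weights by Chebyshev for the TILTED family.
[cite: DemboZeitouni2010, §2.3 (proof of the Gärtner–Ellis lower bound: change of measure; lane statement)] -/
theorem tiltSum_le_window_up (hw : ∀ i ∈ S, 0 ≤ w i) {t τ τ' : ℝ} (ht : 0 ≤ t) (hτ : 0 ≤ τ) (hτ' : 0 ≤ τ') (A A' : ℝ) :
    ∑ i ∈ S, w i * Real.exp (t * X i)
      ≤ Real.exp (t * A') * ∑ i ∈ S.filter (fun i => A ≤ X i), w i
        + Real.exp (-(τ * A')) * ∑ i ∈ S, w i * Real.exp ((t + τ) * X i)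
        + Real.exp (τ' * A) * ∑ i ∈ S, w i * Real.exp ((t - τ') * X i) := by
  set f : ι → ℝ := fun i => w i * Real.exp (t * X i) with hf
  have hf0 : ∀ i ∈ S, 0 ≤ f i := fun i hi => mul_nonneg (hw i hi) (Real.exp_pos _).le
  -- split off `X < A`
  have hsplit1 : ∑ i ∈ S, f i = ∑ i ∈ S.filter (fun i => A ≤ X i), f i + ∑ i ∈ S.filter (fun i => ¬ A ≤ X i), f i :=
    (Finset.sum_filter_add_sum_filter_not S (fun i => A ≤ X i) f).symm
  -- split the first part at `A'`
  have hsplit2 : ∑ i ∈ S.filter (fun i => A ≤ X i), f i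
      = ∑ i ∈ (S.filter (fun i => A ≤ X i)).filter (fun i => X i ≤ A'), f i
        + ∑ i ∈ (S.filter (fun i => A ≤ X i)).filter (fun i => ¬ X i ≤ A'), f i :=
    (Finset.sum_filter_add_sum_filter_not _ (fun i => X i ≤ A') f).symm
  -- (a) the window
  have ha : ∑ i ∈ (S.filter (fun i => A ≤ X i)).filter (fun i => X i ≤ A'), f i
      ≤ Real.exp (t * A') * ∑ i ∈ S.filter (fun i => A ≤ X i), w i := by
    rw [Finset.mul_sum]
    calc ∑ i ∈ (S.filter (fun i => A ≤ X i)).filter (fun i => X i ≤ A'), f i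
        ≤ ∑ i ∈ (S.filter (fun i => A ≤ X i)).filter (fun i => X i ≤ A'), Real.exp (t * A') * w i :=
          Finset.sum_le_sum fun i hi => by
            obtain ⟨hi1, hi2⟩ := Finset.mem_filter.1 hi
            show w i * Real.exp (t * X i) ≤ Real.exp (t * A') * w i
            rw [mul_comm (Real.exp (t * A'))]
            exact mul_le_mul_of_nonneg_left (Real.exp_le_exp.2 (mul_le_mul_of_nonneg_left hi2 ht)) (hw i (Finset.mem_filter.1 hi1).1)
      _ ≤ ∑ i ∈ S.filter (fun i => A ≤ X i), Real.exp (t * A') * w i :=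
          Finset.sum_le_sum_of_subset_of_nonneg (Finset.filter_subset _ _) fun i hi _ =>
            mul_nonneg (Real.exp_pos _).le (hw i (Finset.mem_filter.1 hi).1)
  -- (b) above the window: Chebyshev for the tilted family at `τ`
  have hb : ∑ i ∈ (S.filter (fun i => A ≤ X i)).filter (fun i => ¬ X i ≤ A'), f i
      ≤ Real.exp (-(τ * A')) * ∑ i ∈ S, w i * Real.exp ((t + τ) * X i) := by
    rw [Finset.mul_sum]
    calc ∑ i ∈ (S.filter (fun i => A ≤ X i)).filter (fun i => ¬ X i ≤ A'), f i
        ≤ ∑ i ∈ (S.filter (fun i => A ≤ X i)).filter (fun i => ¬ X i ≤ A'), Real.exp (-(τ * A')) * (w i * Real.exp ((t + τ) * X i)) :=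
          Finset.sum_le_sum fun i hi => by
            obtain ⟨hi1, hi2⟩ := Finset.mem_filter.1 hi
            have hX : A' ≤ X i := (not_le.1 hi2).le
            have e : Real.exp (-(τ * A')) * (w i * Real.exp ((t + τ) * X i)) = f i * Real.exp (τ * (X i - A')) := by
              rw [hf]
              have : Real.exp ((t + τ) * X i) = Real.exp (t * X i) * Real.exp (τ * X i) := by rw [← Real.exp_add]; ring_nf
              rw [this, show τ * (X i - A') = τ * X i + -(τ * A') by ring, Real.exp_add]; ring
            rw [e]
            have h1 : (1 : ℝ) ≤ Real.exp (τ * (X i - A')) := Real.one_le_exp (mul_nonneg hτ (by linarith))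
            have := mul_le_mul_of_nonneg_left h1 (hf0 i (Finset.mem_filter.1 hi1).1)
            rwa [mul_one] at this
      _ ≤ ∑ i ∈ S, Real.exp (-(τ * A')) * (w i * Real.exp ((t + τ) * X i)) :=
          Finset.sum_le_sum_of_subset_of_nonneg ((Finset.filter_subset _ _).trans (Finset.filter_subset _ _)) fun i hi _ =>
            mul_nonneg (Real.exp_pos _).le (mul_nonneg (hw i hi) (Real.exp_pos _).le)
  -- (c) below the window: Chebyshev for the tilted family at `−τ'`
  have hc : ∑ i ∈ S.filter (fun i => ¬ A ≤ X i), f i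
      ≤ Real.exp (τ' * A) * ∑ i ∈ S, w i * Real.exp ((t - τ') * X i) := by
    rw [Finset.mul_sum]
    calc ∑ i ∈ S.filter (fun i => ¬ A ≤ X i), f i
        ≤ ∑ i ∈ S.filter (fun i => ¬ A ≤ X i), Real.exp (τ' * A) * (w i * Real.exp ((t - τ') * X i)) :=
          Finset.sum_le_sum fun i hi => by
            obtain ⟨hi1, hi2⟩ := Finset.mem_filter.1 hi
            have hX : X i ≤ A := (not_le.1 hi2).le
            have e : Real.exp (τ' * A) * (w i * Real.exp ((t - τ') * X i)) = f i * Real.exp (τ' * (A - X i)) := by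
              rw [hf]
              have : Real.exp ((t - τ') * X i) = Real.exp (t * X i) * Real.exp (-(τ' * X i)) := by rw [← Real.exp_add]; ring_nf
              rw [this, show τ' * (A - X i) = τ' * A + -(τ' * X i) by ring, Real.exp_add]; ring
            rw [e]
            have h1 : (1 : ℝ) ≤ Real.exp (τ' * (A - X i)) := Real.one_le_exp (mul_nonneg hτ' (by linarith))
            have := mul_le_mul_of_nonneg_left h1 (hf0 i hi1)
            rwa [mul_one] at this
      _ ≤ ∑ i ∈ S, Real.exp (τ' * A) * (w i * Real.exp ((t - τ') * X i)) :=
          Finset.sum_le_sum_of_subset_of_nonneg (Finset.filter_subset _ _) fun i hi _ =>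
            mul_nonneg (Real.exp_pos _).le (mul_nonneg (hw i hi) (Real.exp_pos _).le)
  rw [hsplit1, hsplit2]
  linarith [ha, hb, hc]

open Classical in
/-- ★★ **THE WINDOW LOWER BOUND, downward tilt**: for `t ≤ 0`, `τ, τ' ≥ 0`:
`Σ_i w_i e^{tX_i} ≤ e^{tA}·Σ_{X ≤ A'} w + e^{−τA'}·Σ w e^{(t+τ)X} + e^{τ'A}·Σ w e^{(t−τ')X}`.
[cite: DemboZeitouni2010, §2.3 (proof of the Gärtner–Ellis lower bound: change of measure; lane statement)] -/
theorem tiltSum_le_window_down (hw : ∀ i ∈ S, 0 ≤ w i) {t τ τ' : ℝ} (ht : t ≤ 0) (hτ : 0 ≤ τ) (hτ' : 0 ≤ τ') (A A' : ℝ) :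
    ∑ i ∈ S, w i * Real.exp (t * X i)
      ≤ Real.exp (t * A) * ∑ i ∈ S.filter (fun i => X i ≤ A'), w i
        + Real.exp (-(τ * A')) * ∑ i ∈ S, w i * Real.exp ((t + τ) * X i)
        + Real.exp (τ' * A) * ∑ i ∈ S, w i * Real.exp ((t - τ') * X i) := by
  -- reflect: `X ↦ −X`, `t ↦ −t`, window `[−A', −A]`, and use the upward bound with the roles of `τ, τ'` exchanged
  have key := tiltSum_le_window_up S w (fun i => - X i) hw (neg_nonneg.2 ht) hτ' hτ (-A') (-A)
  have e0 : ∑ i ∈ S, w i * Real.exp (-t * -X i) = ∑ i ∈ S, w i * Real.exp (t * X i) :=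
    Finset.sum_congr rfl fun i _ => by ring_nf
  have e1 : (S.filter fun i => -A' ≤ -X i) = S.filter fun i => X i ≤ A' :=
    Finset.filter_congr fun i _ => by constructor <;> intro h <;> linarith
  have e2 : ∑ i ∈ S, w i * Real.exp ((-t + τ') * -X i) = ∑ i ∈ S, w i * Real.exp ((t - τ') * X i) :=
    Finset.sum_congr rfl fun i _ => by ring_nf
  have e3 : ∑ i ∈ S, w i * Real.exp ((-t - τ) * -X i) = ∑ i ∈ S, w i * Real.exp ((t + τ) * X i) :=
    Finset.sum_congr rfl fun i _ => by ring_nf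
  rw [e0, e1, e2, e3, show -t * -A = t * A by ring, show -(τ' * -A) = τ' * A by ring, show τ * -A' = -(τ * A') by ring] at key
  linarith [key]

end OneFamily

/-! ## §2 The uniform quadratic expansion and its reflection -/

section Asymptotic

variable {α ι : Type*} {l : Filter α} (S : α → Finset ι) (w X : α → ι → ℝ) (a c : α → ℝ) (H : ℝ)

/-- **UQE is reflection invariant**: if the log-Laplace transform of `(X_n − c_n)/a_n` has the uniform quadratic expansion with curvature `H`,
so has that of `(−X_n − (−c_n))/a_n`. [cite: DemboZeitouni2010, §3.7 (lane plumbing)] -/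
theorem uqe_neg
    (hU : ∀ η : ℝ, 0 < η → ∃ δ : ℝ, 0 < δ ∧ ∀ᶠ n in l, ∀ s : ℝ, |s| ≤ δ * a n →
      |Real.log ((∑ i ∈ S n, w n i * Real.exp (s / a n * X n i)) / ∑ i ∈ S n, w n i) - s * c n / a n - H * s ^ 2 / 2| ≤ η * s ^ 2 + η)
    (η : ℝ) (hη : 0 < η) : ∃ δ : ℝ, 0 < δ ∧ ∀ᶠ n in l, ∀ s : ℝ, |s| ≤ δ * a n →
      |Real.log ((∑ i ∈ S n, w n i * Real.exp (s / a n * (-X n i))) / ∑ i ∈ S n, w n i) - s * (-c n) / a n - H * s ^ 2 / 2|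
        ≤ η * s ^ 2 + η := by
  obtain ⟨δ, hδ, hev⟩ := hU η hη
  refine ⟨δ, hδ, hev.mono fun n hn s hs => ?_⟩
  have h := hn (-s) (by rwa [abs_neg])
  have e1 : ∑ i ∈ S n, w n i * Real.exp (s / a n * -X n i) = ∑ i ∈ S n, w n i * Real.exp (-s / a n * X n i) :=
    Finset.sum_congr rfl fun i _ => by ring_nf
  rw [e1, show s * -c n / a n = -s * c n / a n by ring, show H * s ^ 2 / 2 = H * (-s) ^ 2 / 2 by ring,
    show η * s ^ 2 + η = η * (-s) ^ 2 + η by ring]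
  exact h

/-! ## §3 ★★★ Upper bounds with the Gaussian rate -/

open Classical in
/-- The tilted partition function of a family with nonnegative weights and positive mass is positive.
[cite: DemboZeitouni2010, §2.2 (lane plumbing)] -/
theorem tiltSum_pos_of_sum_pos {S : Finset ι} {w : ι → ℝ} (X : ι → ℝ) (hw : ∀ i ∈ S, 0 ≤ w i) (hZ : 0 < ∑ i ∈ S, w i) (t : ℝ) :
    0 < ∑ i ∈ S, w i * Real.exp (t * X i) := by
  obtain ⟨i, hi, hwi⟩ : ∃ i ∈ S, 0 < w i := by
    by_contra! h
    exact absurd (Finset.sum_nonpos h) (not_le.2 hZ)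
  exact Finset.sum_pos' (fun j hj => mul_nonneg (hw j hj) (Real.exp_pos _).le) ⟨i, hi, mul_pos hwi (Real.exp_pos _)⟩

/-- (algebra) the exponent of the Chebyshev bound at the tilt `ξ/H`. [cite: DemboZeitouni2010, §3.7 (lane plumbing)] -/
private theorem mdp_upper_alg {H η r : ℝ} (hH : 0 < H) (hη : 0 ≤ η) (hr : 1 ≤ r) :
    -(r * (H * r)) + H * r ^ 2 / 2 + (η * H / 4 * r ^ 2 + η * H / 4) ≤ -((1 - η) * (H * r) ^ 2 / (2 * H)) := by
  have e : -((1 - η) * (H * r) ^ 2 / (2 * H)) = -((1 - η) * H * r ^ 2 / 2) := by field_simp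
  rw [e]
  have h1 : η * H / 4 ≤ η * H / 4 * r ^ 2 := by
    have : (1 : ℝ) ≤ r ^ 2 := by nlinarith
    have h0 : 0 ≤ η * H / 4 := by positivity
    nlinarith
  nlinarith [h1]

open Classical in
/-- ★★★ **MODERATE DEVIATIONS, UPPER TAIL, UPPER BOUND.**  Under UQE with curvature `H > 0` (nonnegative weights with positive total mass,
scale `a_n > 0`), for every sequence `ξ_n → ∞` with `ξ_n/a_n → 0` and every `η > 0`: eventually
`P_n(X_n ≥ c_n + ξ_n a_n) ≤ exp(−(1−η)·ξ_n²/(2H))` — exponential Chebyshev at the tilt `s_n = ξ_n/H` (admissible: `s_n ≤ δ a_n` eventually).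
[cite: DemboZeitouni2010, §3.7 (moderate deviations) and §2.3 (exponential Chebyshev); lane statement] -/
theorem eventually_upperTail_le_exp_of_uqe (hH : 0 < H) (hw : ∀ᶠ n in l, ∀ i ∈ S n, 0 ≤ w n i)
    (hZ : ∀ᶠ n in l, 0 < ∑ i ∈ S n, w n i) (ha : ∀ᶠ n in l, 0 < a n)
    (hU : ∀ η : ℝ, 0 < η → ∃ δ : ℝ, 0 < δ ∧ ∀ᶠ n in l, ∀ s : ℝ, |s| ≤ δ * a n →
      |Real.log ((∑ i ∈ S n, w n i * Real.exp (s / a n * X n i)) / ∑ i ∈ S n, w n i) - s * c n / a n - H * s ^ 2 / 2| ≤ η * s ^ 2 + η)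
    {ξ : α → ℝ} (hξ : Tendsto ξ l atTop) (hξa : Tendsto (fun n => ξ n / a n) l (𝓝 0)) {η : ℝ} (hη : 0 < η) :
    ∀ᶠ n in l, (∑ i ∈ (S n).filter (fun i => c n + ξ n * a n ≤ X n i), w n i) / (∑ i ∈ S n, w n i)
      ≤ Real.exp (-((1 - η) * ξ n ^ 2 / (2 * H))) := by
  obtain ⟨δ, hδ, hunif⟩ := hU (η * H / 4) (by positivity)
  have hx1 : ∀ᶠ n in l, H ≤ ξ n := hξ.eventually (eventually_ge_atTop H)
  have hx2 : ∀ᶠ n in l, ξ n / a n ≤ δ * H :=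
    (hξa.eventually (Iic_mem_nhds (by positivity : (0 : ℝ) < δ * H))).mono fun n hn => hn
  filter_upwards [hunif, hx1, hx2, hw, hZ, ha] with n hUn hxH hxa hwn hZn han
  have hξ0 : 0 < ξ n := lt_of_lt_of_le hH hxH
  obtain ⟨r, hr⟩ : ∃ r : ℝ, r = ξ n / H := ⟨_, rfl⟩
  have hr0 : 0 < r := by rw [hr]; exact div_pos hξ0 hH
  have hξr : ξ n = H * r := by rw [hr]; field_simp
  have hr1 : 1 ≤ r := by rw [hr, le_div_iff₀ hH, one_mul]; exact hxH
  have hsδ : |r| ≤ δ * a n := by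
    rw [abs_of_pos hr0, hr, div_le_iff₀ hH]
    have := (div_le_iff₀ han).1 hxa
    nlinarith
  have hlog := (abs_le.1 (hUn r hsδ)).2
  have hZt0 := tiltSum_pos_of_sum_pos (X n) hwn hZn (r / a n)
  have hcheb := exp_mul_sum_filter_ge_le_tiltSum (S n) (w n) (X n) hwn (div_pos hr0 han).le (c n + ξ n * a n)
  have hL : Real.exp (Real.log ((∑ i ∈ S n, w n i * Real.exp (r / a n * X n i)) / ∑ i ∈ S n, w n i))
      = (∑ i ∈ S n, w n i * Real.exp (r / a n * X n i)) / ∑ i ∈ S n, w n i := Real.exp_log (div_pos hZt0 hZn)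
  have h1 : (∑ i ∈ (S n).filter (fun i => c n + ξ n * a n ≤ X n i), w n i) / (∑ i ∈ S n, w n i)
      ≤ Real.exp (-(r / a n * (c n + ξ n * a n))
          + Real.log ((∑ i ∈ S n, w n i * Real.exp (r / a n * X n i)) / ∑ i ∈ S n, w n i)) := by
    rw [Real.exp_add, hL, ← mul_div_assoc, div_le_div_iff_of_pos_right hZn, Real.exp_neg, ← div_eq_inv_mul,
      le_div_iff₀ (Real.exp_pos _), mul_comm]
    exact hcheb
  refine h1.trans (Real.exp_le_exp.2 ?_)
  have e2 : r / a n * (c n + ξ n * a n) = r * c n / a n + r * ξ n := by field_simp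
  rw [e2, hξr]
  have alg := mdp_upper_alg hH hη.le hr1
  linarith [alg, hlog]

open Classical in
/-- ★★★ **MODERATE DEVIATIONS, LOWER TAIL, UPPER BOUND**: under the same hypotheses, eventually
`P_n(X_n ≤ c_n − ξ_n a_n) ≤ exp(−(1−η)·ξ_n²/(2H))` (the upper-tail bound for the reflected family `−X_n`, `−c_n`).
[cite: DemboZeitouni2010, §3.7 (moderate deviations) and §2.3 (exponential Chebyshev); lane statement] -/
theorem eventually_lowerTail_le_exp_of_uqe (hH : 0 < H) (hw : ∀ᶠ n in l, ∀ i ∈ S n, 0 ≤ w n i)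
    (hZ : ∀ᶠ n in l, 0 < ∑ i ∈ S n, w n i) (ha : ∀ᶠ n in l, 0 < a n)
    (hU : ∀ η : ℝ, 0 < η → ∃ δ : ℝ, 0 < δ ∧ ∀ᶠ n in l, ∀ s : ℝ, |s| ≤ δ * a n →
      |Real.log ((∑ i ∈ S n, w n i * Real.exp (s / a n * X n i)) / ∑ i ∈ S n, w n i) - s * c n / a n - H * s ^ 2 / 2| ≤ η * s ^ 2 + η)
    {ξ : α → ℝ} (hξ : Tendsto ξ l atTop) (hξa : Tendsto (fun n => ξ n / a n) l (𝓝 0)) {η : ℝ} (hη : 0 < η) :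
    ∀ᶠ n in l, (∑ i ∈ (S n).filter (fun i => X n i ≤ c n - ξ n * a n), w n i) / (∑ i ∈ S n, w n i)
      ≤ Real.exp (-((1 - η) * ξ n ^ 2 / (2 * H))) := by
  have h := eventually_upperTail_le_exp_of_uqe S w (fun n i => -X n i) a (fun n => -c n) H hH hw hZ ha
    (uqe_neg S w X a c H hU) hξ hξa hη
  refine h.mono fun n hn => ?_
  have e : ((S n).filter fun i => -c n + ξ n * a n ≤ -X n i) = (S n).filter fun i => X n i ≤ c n - ξ n * a n :=
    Finset.filter_congr fun i _ => by constructor <;> intro h <;> linarith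
  rw [e] at hn
  exact hn

/-! ## §4 ★★★ Lower bounds with the Gaussian rate (Cramér's change of measure at the moderate tilt) -/

/-- (algebra) the tail of the tilted family above the window is negligible. [cite: DemboZeitouni2010, §2.3 (lane plumbing)] -/
private theorem mdp_lower_alg_above {H κ r : ℝ} (hH : 0 < H) (hκ0 : 0 ≤ κ) (hκ : κ ≤ 1 / 8) (hr : 1 ≤ r) :
    -(κ * r * ((1 + 2 * κ) * (H * r))) + H * ((1 + 2 * κ) * r) ^ 2 / 2 - H * ((1 + κ) * r) ^ 2 / 2
        + (κ ^ 2 * H / 32 * ((1 + 2 * κ) * r) ^ 2 + κ ^ 2 * H / 32)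
        + (κ ^ 2 * H / 32 * ((1 + κ) * r) ^ 2 + κ ^ 2 * H / 32)
      ≤ -(κ ^ 2 * (H * r) ^ 2 / (4 * H)) := by
  have e : -(κ ^ 2 * (H * r) ^ 2 / (4 * H)) = -(H * κ ^ 2 * r ^ 2 / 4) := by field_simp
  rw [e]
  have hr2 : (1 : ℝ) ≤ r ^ 2 := by nlinarith
  have P : 0 ≤ H * κ ^ 2 * r ^ 2 := by positivity
  have h3 : 2 + 6 * κ + 5 * κ ^ 2 ≤ 3 := by nlinarith
  have h4 : κ ^ 2 * H / 32 * ((1 + 2 * κ) * r) ^ 2 + κ ^ 2 * H / 32 * ((1 + κ) * r) ^ 2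
      = H * κ ^ 2 * r ^ 2 / 32 * (2 + 6 * κ + 5 * κ ^ 2) := by ring
  have h5 : H * κ ^ 2 * r ^ 2 / 32 * (2 + 6 * κ + 5 * κ ^ 2) ≤ H * κ ^ 2 * r ^ 2 / 32 * 3 :=
    mul_le_mul_of_nonneg_left h3 (by positivity)
  have h6 : κ ^ 2 * H / 32 + κ ^ 2 * H / 32 ≤ H * κ ^ 2 * r ^ 2 / 16 := by
    have : H * κ ^ 2 * 1 ≤ H * κ ^ 2 * r ^ 2 := mul_le_mul_of_nonneg_left hr2 (by positivity)
    linarith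
  have h7 : -(κ * r * ((1 + 2 * κ) * (H * r))) + H * ((1 + 2 * κ) * r) ^ 2 / 2 - H * ((1 + κ) * r) ^ 2 / 2
      = -(H * κ ^ 2 * r ^ 2 / 2) := by ring
  linarith [h4, h5, h6, h7]

/-- (algebra) the tail of the tilted family below the window is negligible. [cite: DemboZeitouni2010, §2.3 (lane plumbing)] -/
private theorem mdp_lower_alg_below {H κ r : ℝ} (hH : 0 < H) (hκ0 : 0 ≤ κ) (hκ : κ ≤ 1 / 8) (hr : 1 ≤ r) :
    κ * r * (H * r) + H * ((1 + κ) * r - κ * r) ^ 2 / 2 - H * ((1 + κ) * r) ^ 2 / 2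
        + (κ ^ 2 * H / 32 * ((1 + κ) * r - κ * r) ^ 2 + κ ^ 2 * H / 32)
        + (κ ^ 2 * H / 32 * ((1 + κ) * r) ^ 2 + κ ^ 2 * H / 32)
      ≤ -(κ ^ 2 * (H * r) ^ 2 / (4 * H)) := by
  have e : -(κ ^ 2 * (H * r) ^ 2 / (4 * H)) = -(H * κ ^ 2 * r ^ 2 / 4) := by field_simp
  rw [e]
  have hr2 : (1 : ℝ) ≤ r ^ 2 := by nlinarith
  have P : 0 ≤ H * κ ^ 2 * r ^ 2 := by positivity
  have h3 : 2 + 2 * κ + κ ^ 2 ≤ 3 := by nlinarith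
  have h4 : κ ^ 2 * H / 32 * ((1 + κ) * r - κ * r) ^ 2 + κ ^ 2 * H / 32 * ((1 + κ) * r) ^ 2
      = H * κ ^ 2 * r ^ 2 / 32 * (2 + 2 * κ + κ ^ 2) := by ring
  have h5 : H * κ ^ 2 * r ^ 2 / 32 * (2 + 2 * κ + κ ^ 2) ≤ H * κ ^ 2 * r ^ 2 / 32 * 3 :=
    mul_le_mul_of_nonneg_left h3 (by positivity)
  have h6 : κ ^ 2 * H / 32 + κ ^ 2 * H / 32 ≤ H * κ ^ 2 * r ^ 2 / 16 := by
    have : H * κ ^ 2 * 1 ≤ H * κ ^ 2 * r ^ 2 := mul_le_mul_of_nonneg_left hr2 (by positivity)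
    linarith
  have h7 : κ * r * (H * r) + H * ((1 + κ) * r - κ * r) ^ 2 / 2 - H * ((1 + κ) * r) ^ 2 / 2 = -(H * κ ^ 2 * r ^ 2 / 2) := by ring
  linarith [h4, h5, h6, h7]

/-- (algebra) the exponent recovered on the window. [cite: DemboZeitouni2010, §2.3 (lane plumbing)] -/
private theorem mdp_lower_alg_main {H κ r : ℝ} (hH : 0 < H) (hκ0 : 0 ≤ κ) (hκ : κ ≤ 1 / 8) (hr : 1 ≤ r)
    (hL : Real.log 2 ≤ κ * (H * r) ^ 2 / (2 * H)) :
    -((1 + 8 * κ) * (H * r) ^ 2 / (2 * H))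
      ≤ H * ((1 + κ) * r) ^ 2 / 2 - (κ ^ 2 * H / 32 * ((1 + κ) * r) ^ 2 + κ ^ 2 * H / 32)
          - (1 + κ) * r * ((1 + 2 * κ) * (H * r)) - Real.log 2 := by
  have e1 : -((1 + 8 * κ) * (H * r) ^ 2 / (2 * H)) = -((1 + 8 * κ) * H * r ^ 2 / 2) := by field_simp
  have e2 : κ * (H * r) ^ 2 / (2 * H) = κ * H * r ^ 2 / 2 := by field_simp
  rw [e1]
  rw [e2] at hL
  have hr2 : (1 : ℝ) ≤ r ^ 2 := by nlinarith
  have P : 0 ≤ H * κ * r ^ 2 := by positivity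
  have P2 : 0 ≤ H * κ ^ 2 * r ^ 2 := by positivity
  have hk2 : κ ^ 2 ≤ κ / 8 := by nlinarith
  have h3 : (1 + κ) ^ 2 ≤ 2 := by nlinarith
  have h4 : κ ^ 2 * H / 32 * ((1 + κ) * r) ^ 2 = H * κ ^ 2 * r ^ 2 / 32 * (1 + κ) ^ 2 := by ring
  have h5 : H * κ ^ 2 * r ^ 2 / 32 * (1 + κ) ^ 2 ≤ H * κ ^ 2 * r ^ 2 / 32 * 2 := mul_le_mul_of_nonneg_left h3 (by positivity)
  have h6 : κ ^ 2 * H / 32 ≤ H * κ ^ 2 * r ^ 2 / 32 := by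
    have : H * κ ^ 2 * 1 ≤ H * κ ^ 2 * r ^ 2 := mul_le_mul_of_nonneg_left hr2 (by positivity)
    linarith
  have h7 : H * κ ^ 2 * r ^ 2 ≤ H * κ * r ^ 2 / 8 := by
    have := mul_le_mul_of_nonneg_left hk2 (show (0 : ℝ) ≤ H * r ^ 2 by positivity)
    linarith
  have h8 : H * ((1 + κ) * r) ^ 2 / 2 - (1 + κ) * r * ((1 + 2 * κ) * (H * r))
      = -(H * r ^ 2 / 2) - 2 * (H * κ * r ^ 2) - 3 / 2 * (H * κ ^ 2 * r ^ 2) := by ring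
  linarith only [h4, h5, h6, h7, h8, hL, P, P2]

open Classical in
/-- ★★★ **MODERATE DEVIATIONS, UPPER TAIL, LOWER BOUND.**  Under UQE with curvature `H > 0`, for `ξ_n → ∞` with `ξ_n/a_n → 0` and every `η > 0`:
eventually `P_n(X_n ≥ c_n + ξ_n a_n) ≥ exp(−(1+η)·ξ_n²/(2H))`.  Proof: change of measure to the tilt `s = (1+κ)ξ_n/H` (`κ = min(η,1)/8`),
window `c_n + ξ_n a_n ≤ X ≤ c_n + (1+2κ)ξ_n a_n` (`tiltSum_le_window_up` with `τ = τ' = κξ_n/(H a_n)`), the two tails of the tilted family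
cost a factor `e^{−κ²ξ_n²/(4H)} ≤ ¼` each by UQE at `s ± κξ_n/H`, and on the window the tilt is undone at the price `e^{−s(1+2κ)ξ_n}`.
[cite: DemboZeitouni2010, §2.3 (Gärtner–Ellis lower bound: change of measure + upper bound under the tilt) and §3.7; lane statement] -/
theorem eventually_exp_le_upperTail_of_uqe (hH : 0 < H) (hw : ∀ᶠ n in l, ∀ i ∈ S n, 0 ≤ w n i)
    (hZ : ∀ᶠ n in l, 0 < ∑ i ∈ S n, w n i) (ha : ∀ᶠ n in l, 0 < a n)
    (hU : ∀ η : ℝ, 0 < η → ∃ δ : ℝ, 0 < δ ∧ ∀ᶠ n in l, ∀ s : ℝ, |s| ≤ δ * a n →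
      |Real.log ((∑ i ∈ S n, w n i * Real.exp (s / a n * X n i)) / ∑ i ∈ S n, w n i) - s * c n / a n - H * s ^ 2 / 2| ≤ η * s ^ 2 + η)
    {ξ : α → ℝ} (hξ : Tendsto ξ l atTop) (hξa : Tendsto (fun n => ξ n / a n) l (𝓝 0)) {η : ℝ} (hη : 0 < η) :
    ∀ᶠ n in l, Real.exp (-((1 + η) * ξ n ^ 2 / (2 * H)))
      ≤ (∑ i ∈ (S n).filter (fun i => c n + ξ n * a n ≤ X n i), w n i) / (∑ i ∈ S n, w n i) := by
  -- reduce to `η ≤ 1` through `κ = min η 1 / 8`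
  set κ := min η 1 / 8 with hκ
  have hκ0 : 0 < κ := by rw [hκ]; exact div_pos (lt_min hη one_pos) (by norm_num)
  have hκ1 : κ ≤ 1 / 8 := by rw [hκ]; linarith [min_le_right η 1]
  have hκη : 8 * κ ≤ η := by rw [hκ]; linarith [min_le_left η 1]
  obtain ⟨δ, hδ, hunif⟩ := hU (κ ^ 2 * H / 32) (by positivity)
  have hξ2 : Tendsto (fun n => ξ n ^ 2) l atTop := (tendsto_pow_atTop two_ne_zero).comp hξ
  have ev1 : ∀ᶠ n in l, H ≤ ξ n := hξ.eventually (eventually_ge_atTop H)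
  have ev2 : ∀ᶠ n in l, ξ n / a n ≤ δ * H / 2 :=
    (hξa.eventually (Iic_mem_nhds (by positivity : (0 : ℝ) < δ * H / 2))).mono fun n hn => hn
  have ev3 : ∀ᶠ n in l, Real.log 4 ≤ κ ^ 2 * ξ n ^ 2 / (4 * H) := by
    have : Tendsto (fun n => κ ^ 2 * ξ n ^ 2 / (4 * H)) l atTop :=
      (hξ2.const_mul_atTop (by positivity)).atTop_div_const (by positivity)
    exact this.eventually (eventually_ge_atTop _)
  have ev4 : ∀ᶠ n in l, Real.log 2 ≤ κ * ξ n ^ 2 / (2 * H) := by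
    have : Tendsto (fun n => κ * ξ n ^ 2 / (2 * H)) l atTop :=
      (hξ2.const_mul_atTop hκ0).atTop_div_const (by positivity)
    exact this.eventually (eventually_ge_atTop _)
  filter_upwards [hunif, ev1, ev2, ev3, ev4, hw, hZ, ha] with n hUn hxH hxa hl4 hl2 hwn hZn han
  have hξ0 : 0 < ξ n := lt_of_lt_of_le hH hxH
  obtain ⟨r, hr⟩ : ∃ r : ℝ, r = ξ n / H := ⟨_, rfl⟩
  have hr0 : 0 < r := by rw [hr]; exact div_pos hξ0 hH
  have hξr : ξ n = H * r := by rw [hr]; field_simp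
  have hr1 : 1 ≤ r := by rw [hr, le_div_iff₀ hH, one_mul]; exact hxH
  -- admissible tilts: everything up to `(1+2κ) r ≤ (5/4) r ≤ δ a`
  have hadm : ∀ u : ℝ, 0 ≤ u → u ≤ (1 + 2 * κ) * r → |u| ≤ δ * a n := by
    intro u hu0 hu
    rw [abs_of_nonneg hu0]
    refine hu.trans ?_
    have h1 : r ≤ δ * a n / 2 := by
      rw [hr, div_le_iff₀ hH]
      have := (div_le_iff₀ han).1 hxa
      nlinarith
    nlinarith [han, hδ]
  set s := (1 + κ) * r with hs
  set ρ := κ * r with hρ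
  have hs0 : 0 < s := by positivity
  have hρ0 : 0 < ρ := by positivity
  have hρs : ρ ≤ s := by rw [hs, hρ]; nlinarith
  have hU0 := hUn s (hadm s hs0.le (by rw [hs]; nlinarith))
  have hU1 := hUn (s + ρ) (hadm (s + ρ) (by positivity) (by rw [hs, hρ]; nlinarith))
  have hU2 := hUn (s - ρ) (hadm (s - ρ) (by linarith) (by rw [hs, hρ]; nlinarith))
  -- the three tilted partition functions as `Z₀·e^{L}`; `γ = c_n/a_n`
  set Z0 := ∑ i ∈ S n, w n i with hZ0
  obtain ⟨γ, hγ⟩ : ∃ γ : ℝ, c n / a n = γ := ⟨_, rfl⟩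
  have hmulγ : ∀ u : ℝ, u * c n / a n = u * γ := fun u => by rw [mul_div_assoc, hγ]
  have hpos : ∀ u : ℝ, 0 < (∑ i ∈ S n, w n i * Real.exp (u / a n * X n i)) := fun u => tiltSum_pos_of_sum_pos (X n) hwn hZn _
  have hEL : ∀ u : ℝ, ∑ i ∈ S n, w n i * Real.exp (u / a n * X n i)
      = Z0 * Real.exp (Real.log ((∑ i ∈ S n, w n i * Real.exp (u / a n * X n i)) / Z0)) := fun u => by
    rw [Real.exp_log (div_pos (hpos u) hZn)]; field_simp
  obtain ⟨L0, hL0⟩ : ∃ L : ℝ, Real.log ((∑ i ∈ S n, w n i * Real.exp (s / a n * X n i)) / Z0) = L := ⟨_, rfl⟩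
  obtain ⟨L1, hL1⟩ : ∃ L : ℝ, Real.log ((∑ i ∈ S n, w n i * Real.exp ((s + ρ) / a n * X n i)) / Z0) = L := ⟨_, rfl⟩
  obtain ⟨L2, hL2⟩ : ∃ L : ℝ, Real.log ((∑ i ∈ S n, w n i * Real.exp ((s - ρ) / a n * X n i)) / Z0) = L := ⟨_, rfl⟩
  rw [hL0, hmulγ] at hU0
  rw [hL1, hmulγ] at hU1
  rw [hL2, hmulγ] at hU2
  obtain ⟨hU0l, hU0u⟩ := abs_le.1 hU0
  obtain ⟨-, hU1u⟩ := abs_le.1 hU1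
  obtain ⟨-, hU2u⟩ := abs_le.1 hU2
  -- the window bound
  have hwin := tiltSum_le_window_up (S n) (w n) (X n) hwn (div_pos hs0 han).le (div_pos hρ0 han).le (div_pos hρ0 han).le
    (c n + ξ n * a n) (c n + (1 + 2 * κ) * ξ n * a n)
  rw [show s / a n + ρ / a n = (s + ρ) / a n by ring, show s / a n - ρ / a n = (s - ρ) / a n by ring,
    hEL s, hEL (s + ρ), hEL (s - ρ), hL0, hL1, hL2] at hwin
  set T := ∑ i ∈ (S n).filter (fun i => c n + ξ n * a n ≤ X n i), w n i with hT
  -- exponents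
  have eA' : s / a n * (c n + (1 + 2 * κ) * ξ n * a n) = s * γ + s * ((1 + 2 * κ) * ξ n) := by rw [← hγ]; field_simp
  have eτ : -(ρ / a n * (c n + (1 + 2 * κ) * ξ n * a n)) = -(ρ * γ) - ρ * ((1 + 2 * κ) * ξ n) := by rw [← hγ]; field_simp; ring
  have eτ' : ρ / a n * (c n + ξ n * a n) = ρ * γ + ρ * ξ n := by rw [← hγ]; field_simp
  rw [eA', eτ, eτ'] at hwin
  -- the two tails of the tilted family are each at most a quarter of the main term
  have hq : Real.exp (-(κ ^ 2 * ξ n ^ 2 / (4 * H))) ≤ 1 / 4 := by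
    rw [Real.exp_neg, ← one_div]
    have h4 : (4 : ℝ) ≤ Real.exp (κ ^ 2 * ξ n ^ 2 / (4 * H)) := by
      calc (4 : ℝ) = Real.exp (Real.log 4) := (Real.exp_log (by norm_num)).symm
        _ ≤ _ := Real.exp_le_exp.2 hl4
    exact one_div_le_one_div_of_le (by norm_num) h4
  have habove : Real.exp (-(ρ * γ) - ρ * ((1 + 2 * κ) * ξ n)) * (Z0 * Real.exp L1) ≤ Z0 * Real.exp L0 * (1 / 4) := by
    have key : -(ρ * γ) - ρ * ((1 + 2 * κ) * ξ n) + L1 ≤ L0 + -(κ ^ 2 * ξ n ^ 2 / (4 * H)) := by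
      have alg := mdp_lower_alg_above hH hκ0.le hκ1 hr1
      rw [hξr]
      simp only [hs, hρ] at hU1u hU0l ⊢
      linarith only [alg, hU1u, hU0l]
    calc Real.exp (-(ρ * γ) - ρ * ((1 + 2 * κ) * ξ n)) * (Z0 * Real.exp L1)
        = Z0 * Real.exp (-(ρ * γ) - ρ * ((1 + 2 * κ) * ξ n) + L1) := by
          rw [Real.exp_add (-(ρ * γ) - ρ * ((1 + 2 * κ) * ξ n)) L1]; ring
      _ ≤ Z0 * Real.exp (L0 + -(κ ^ 2 * ξ n ^ 2 / (4 * H))) := mul_le_mul_of_nonneg_left (Real.exp_le_exp.2 key) hZn.le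
      _ = Z0 * Real.exp L0 * Real.exp (-(κ ^ 2 * ξ n ^ 2 / (4 * H))) := by rw [Real.exp_add]; ring
      _ ≤ Z0 * Real.exp L0 * (1 / 4) := mul_le_mul_of_nonneg_left hq (by positivity)
  have hbelow : Real.exp (ρ * γ + ρ * ξ n) * (Z0 * Real.exp L2) ≤ Z0 * Real.exp L0 * (1 / 4) := by
    have key : ρ * γ + ρ * ξ n + L2 ≤ L0 + -(κ ^ 2 * ξ n ^ 2 / (4 * H)) := by
      have alg := mdp_lower_alg_below hH hκ0.le hκ1 hr1
      rw [hξr]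
      simp only [hs, hρ] at hU2u hU0l ⊢
      linarith only [alg, hU2u, hU0l]
    calc Real.exp (ρ * γ + ρ * ξ n) * (Z0 * Real.exp L2)
        = Z0 * Real.exp (ρ * γ + ρ * ξ n + L2) := by rw [Real.exp_add (ρ * γ + ρ * ξ n) L2]; ring
      _ ≤ Z0 * Real.exp (L0 + -(κ ^ 2 * ξ n ^ 2 / (4 * H))) := mul_le_mul_of_nonneg_left (Real.exp_le_exp.2 key) hZn.le
      _ = Z0 * Real.exp L0 * Real.exp (-(κ ^ 2 * ξ n ^ 2 / (4 * H))) := by rw [Real.exp_add]; ring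
      _ ≤ Z0 * Real.exp L0 * (1 / 4) := mul_le_mul_of_nonneg_left hq (by positivity)
  -- hence `e^{tA'} T ≥ Z₀ e^{L0}/2`
  have hmain : Z0 * Real.exp L0 / 2 ≤ Real.exp (s * γ + s * ((1 + 2 * κ) * ξ n)) * T := by linarith only [hwin, habove, hbelow]
  -- undo the tilt on the window
  have hfin : Z0 * Real.exp (-((1 + η) * ξ n ^ 2 / (2 * H))) ≤ T := by
    have h2 : Z0 * (Real.exp (L0 - (s * γ + s * ((1 + 2 * κ) * ξ n)) - Real.log 2)) ≤ T := by
      have hB := Real.exp_pos (s * γ + s * ((1 + 2 * κ) * ξ n))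
      rw [Real.exp_sub, Real.exp_sub, Real.exp_log (by norm_num : (0 : ℝ) < 2),
        show Z0 * (Real.exp L0 / Real.exp (s * γ + s * ((1 + 2 * κ) * ξ n)) / 2)
          = (Z0 * Real.exp L0 / 2) / Real.exp (s * γ + s * ((1 + 2 * κ) * ξ n)) by ring,
        div_le_iff₀ hB]
      linarith only [hmain]
    refine le_trans (mul_le_mul_of_nonneg_left (Real.exp_le_exp.2 ?_) hZn.le) h2
    have alg := mdp_lower_alg_main hH hκ0.le hκ1 hr1 (by rw [← hξr]; exact hl2)
    have hmono : -((1 + η) * ξ n ^ 2 / (2 * H)) ≤ -((1 + 8 * κ) * ξ n ^ 2 / (2 * H)) := by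
      have : (1 + 8 * κ) * ξ n ^ 2 / (2 * H) ≤ (1 + η) * ξ n ^ 2 / (2 * H) :=
        div_le_div_of_nonneg_right (mul_le_mul_of_nonneg_right (by linarith) (sq_nonneg _)) (by positivity)
      linarith
    refine hmono.trans ?_
    rw [hξr]
    simp only [hs] at hU0l ⊢
    linarith only [alg, hU0l]
  rwa [le_div_iff₀ hZn, mul_comm]

open Classical in
/-- ★★★ **MODERATE DEVIATIONS, LOWER TAIL, LOWER BOUND**: eventually `P_n(X_n ≤ c_n − ξ_n a_n) ≥ exp(−(1+η)·ξ_n²/(2H))` (reflection).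
[cite: DemboZeitouni2010, §2.3 (Gärtner–Ellis lower bound) and §3.7; lane statement] -/
theorem eventually_exp_le_lowerTail_of_uqe (hH : 0 < H) (hw : ∀ᶠ n in l, ∀ i ∈ S n, 0 ≤ w n i)
    (hZ : ∀ᶠ n in l, 0 < ∑ i ∈ S n, w n i) (ha : ∀ᶠ n in l, 0 < a n)
    (hU : ∀ η : ℝ, 0 < η → ∃ δ : ℝ, 0 < δ ∧ ∀ᶠ n in l, ∀ s : ℝ, |s| ≤ δ * a n →
      |Real.log ((∑ i ∈ S n, w n i * Real.exp (s / a n * X n i)) / ∑ i ∈ S n, w n i) - s * c n / a n - H * s ^ 2 / 2| ≤ η * s ^ 2 + η)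
    {ξ : α → ℝ} (hξ : Tendsto ξ l atTop) (hξa : Tendsto (fun n => ξ n / a n) l (𝓝 0)) {η : ℝ} (hη : 0 < η) :
    ∀ᶠ n in l, Real.exp (-((1 + η) * ξ n ^ 2 / (2 * H)))
      ≤ (∑ i ∈ (S n).filter (fun i => X n i ≤ c n - ξ n * a n), w n i) / (∑ i ∈ S n, w n i) := by
  have h := eventually_exp_le_upperTail_of_uqe S w (fun n i => -X n i) a (fun n => -c n) H hH hw hZ ha
    (uqe_neg S w X a c H hU) hξ hξa hη
  refine h.mono fun n hn => ?_
  have e : ((S n).filter fun i => -c n + ξ n * a n ≤ -X n i) = (S n).filter fun i => X n i ≤ c n - ξ n * a n :=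
    Finset.filter_congr fun i _ => by constructor <;> intro h <;> linarith
  rw [e] at hn
  exact hn

/-! ## §5 ★★★ The moderate deviation principle -/

/-- (plumbing) a two-sided exponential squeeze gives the limit of `ξ^{-2} log P`. [cite: DemboZeitouni2010, §3.7 (lane plumbing)] -/
private theorem tendsto_log_div_sq_of_squeeze {P ξ : α → ℝ} (hH : 0 < H) (hξ : Tendsto ξ l atTop)
    (hup : ∀ η : ℝ, 0 < η → ∀ᶠ n in l, P n ≤ Real.exp (-((1 - η) * ξ n ^ 2 / (2 * H))))
    (hlo : ∀ η : ℝ, 0 < η → ∀ᶠ n in l, Real.exp (-((1 + η) * ξ n ^ 2 / (2 * H))) ≤ P n) :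
    Tendsto (fun n => Real.log (P n) / ξ n ^ 2) l (𝓝 (-(1 / (2 * H)))) := by
  rw [Metric.tendsto_nhds]
  intro ε hε
  have hη : 0 < ε * H := by positivity
  have hξ1 : ∀ᶠ n in l, 1 ≤ ξ n := hξ.eventually (eventually_ge_atTop 1)
  filter_upwards [hup (ε * H) hη, hlo (ε * H) hη, hξ1] with n hu hl' h1
  have hξ2 : 0 < ξ n ^ 2 := by positivity
  have hP : 0 < P n := lt_of_lt_of_le (Real.exp_pos _) hl'
  have hlogu : Real.log (P n) ≤ -((1 - ε * H) * ξ n ^ 2 / (2 * H)) := by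
    have := Real.log_le_log hP hu; rwa [Real.log_exp] at this
  have hlogl : -((1 + ε * H) * ξ n ^ 2 / (2 * H)) ≤ Real.log (P n) := by
    have := Real.log_le_log (Real.exp_pos _) hl'; rwa [Real.log_exp] at this
  rw [Real.dist_eq, abs_lt]
  constructor
  · have : -(1 / (2 * H)) - ε < Real.log (P n) / ξ n ^ 2 := by
      rw [lt_div_iff₀ hξ2]
      have e : (-(1 / (2 * H)) - ε) * ξ n ^ 2 = -((1 + 2 * (ε * H)) * ξ n ^ 2 / (2 * H)) := by field_simp; ring
      rw [e]
      refine lt_of_lt_of_le ?_ hlogl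
      have : (1 + ε * H) * ξ n ^ 2 / (2 * H) < (1 + 2 * (ε * H)) * ξ n ^ 2 / (2 * H) :=
        div_lt_div_of_pos_right (mul_lt_mul_of_pos_right (by linarith) hξ2) (by positivity)
      linarith
    linarith
  · have : Real.log (P n) / ξ n ^ 2 < -(1 / (2 * H)) + ε := by
      rw [div_lt_iff₀ hξ2]
      have e : (-(1 / (2 * H)) + ε) * ξ n ^ 2 = -((1 - 2 * (ε * H)) * ξ n ^ 2 / (2 * H)) := by field_simp; ring
      rw [e]
      refine lt_of_le_of_lt hlogu ?_
      have : (1 - 2 * (ε * H)) * ξ n ^ 2 / (2 * H) < (1 - ε * H) * ξ n ^ 2 / (2 * H) :=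
        div_lt_div_of_pos_right (mul_lt_mul_of_pos_right (by linarith) hξ2) (by positivity)
      linarith
    linarith

open Classical in
/-- ★★★ **THE MODERATE DEVIATION PRINCIPLE, upper tail**: under UQE with curvature `H > 0`, for every `ξ_n → ∞` with `ξ_n/a_n → 0`,
`ξ_n^{-2} · log P_n(X_n ≥ c_n + ξ_n a_n) → −1/(2H)`. [cite: DemboZeitouni2010, §3.7 Theorem 3.7.1 (moderate deviations; lane statement for
finitely supported laws under the uniform quadratic expansion)] -/
theorem tendsto_log_upperTail_div_sq_of_uqe (hH : 0 < H) (hw : ∀ᶠ n in l, ∀ i ∈ S n, 0 ≤ w n i)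
    (hZ : ∀ᶠ n in l, 0 < ∑ i ∈ S n, w n i) (ha : ∀ᶠ n in l, 0 < a n)
    (hU : ∀ η : ℝ, 0 < η → ∃ δ : ℝ, 0 < δ ∧ ∀ᶠ n in l, ∀ s : ℝ, |s| ≤ δ * a n →
      |Real.log ((∑ i ∈ S n, w n i * Real.exp (s / a n * X n i)) / ∑ i ∈ S n, w n i) - s * c n / a n - H * s ^ 2 / 2| ≤ η * s ^ 2 + η)
    {ξ : α → ℝ} (hξ : Tendsto ξ l atTop) (hξa : Tendsto (fun n => ξ n / a n) l (𝓝 0)) :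
    Tendsto (fun n => Real.log ((∑ i ∈ (S n).filter (fun i => c n + ξ n * a n ≤ X n i), w n i) / (∑ i ∈ S n, w n i))
      / ξ n ^ 2) l (𝓝 (-(1 / (2 * H)))) :=
  tendsto_log_div_sq_of_squeeze H hH hξ
    (fun _ hη => eventually_upperTail_le_exp_of_uqe S w X a c H hH hw hZ ha hU hξ hξa hη)
    (fun _ hη => eventually_exp_le_upperTail_of_uqe S w X a c H hH hw hZ ha hU hξ hξa hη)

open Classical in
/-- ★★★ **THE MODERATE DEVIATION PRINCIPLE, lower tail**: `ξ_n^{-2} · log P_n(X_n ≤ c_n − ξ_n a_n) → −1/(2H)`.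
[cite: DemboZeitouni2010, §3.7 Theorem 3.7.1 (moderate deviations; lane statement)] -/
theorem tendsto_log_lowerTail_div_sq_of_uqe (hH : 0 < H) (hw : ∀ᶠ n in l, ∀ i ∈ S n, 0 ≤ w n i)
    (hZ : ∀ᶠ n in l, 0 < ∑ i ∈ S n, w n i) (ha : ∀ᶠ n in l, 0 < a n)
    (hU : ∀ η : ℝ, 0 < η → ∃ δ : ℝ, 0 < δ ∧ ∀ᶠ n in l, ∀ s : ℝ, |s| ≤ δ * a n →
      |Real.log ((∑ i ∈ S n, w n i * Real.exp (s / a n * X n i)) / ∑ i ∈ S n, w n i) - s * c n / a n - H * s ^ 2 / 2| ≤ η * s ^ 2 + η)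
    {ξ : α → ℝ} (hξ : Tendsto ξ l atTop) (hξa : Tendsto (fun n => ξ n / a n) l (𝓝 0)) :
    Tendsto (fun n => Real.log ((∑ i ∈ (S n).filter (fun i => X n i ≤ c n - ξ n * a n), w n i) / (∑ i ∈ S n, w n i))
      / ξ n ^ 2) l (𝓝 (-(1 / (2 * H)))) :=
  tendsto_log_div_sq_of_squeeze H hH hξ
    (fun _ hη => eventually_lowerTail_le_exp_of_uqe S w X a c H hH hw hZ ha hU hξ hξa hη)
    (fun _ hη => eventually_exp_le_lowerTail_of_uqe S w X a c H hH hw hZ ha hU hξ hξa hη)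

end Asymptotic

end Literature.Probability.Moments
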